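import Literature.Analysis.FluidPDE.TorusClassicalNSH2Smoothing
import HarnessLib

/-!
# The odd-order Sobolev balances `d/dt ½‖∇Δⁿu‖₂²` of classical Navier–Stokes solutions on the torus,
# and the flux bounds of the `H²`/`H³` balances on `T³`

Analysis/FluidPDE proof file (theorems only; no definitions, no named facts), sequel of
`TorusClassicalH1Balance.lean` (`d/dt ½‖∇u‖₂²`), `TorusClassicalHnBalance.lean` (the even orders
`d/dt ½‖Δⁿu‖₂²`) and `TorusClassicalNSH2Smoothing.lean` (the `H²` smoothing estimate). For a classical
solution `(u, p)` of the forced incompressible Navier–Stokes system on `T^d × [a, b]`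
(`Torus.IsClassicalNSSolutionOn (Icc a b) ν f u p`) and every `n : ℕ`, the quantity
`½‖∇Δⁿu(t)‖₂² = ½ ∫ ∑ᵢ ‖∂ᵢΔⁿu(t)‖²` (`‖u(t)‖²_{Ḣ^{2n+1}}` up to `(4π²)^{2n+1}`) has the one-sided derivative

`d/dt ½‖∇Δⁿu‖₂² = −ν ‖Δⁿ⁺¹u‖₂² + ∫ ⟪(u·∇)u − f, Δ²ⁿ⁺¹u⟫`

within `[a, b]` (`Torus.IsClassicalNSSolutionOn.hasDerivWithinAt_half_gradNormSq_laplacian_iterate`; the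
case `n = 0` is the enstrophy equation of `TorusClassicalH1Balance`, `n = 1` is spelled out without
iterates as `….hasDerivWithinAt_half_gradNormSq_laplacian`): differentiate `½ ∫ ∑ᵢ ‖∂ᵢΔⁿu‖²` under the
integral, commute `∂ₜ` with `∂ᵢ` and `Δⁿ`, Green (`∑ᵢ ∫ ⟪∂ᵢa, ∂ᵢw⟫ = −∫ ⟪a, Δw⟫`, then
`∫ ⟪Δⁿv, w⟫ = ∫ ⟪v, Δⁿw⟫`), insert the momentum equation and drop the pressure (`Δ²ⁿ⁺¹u` is divergence
free) — "the inner product of the momentum equation with `A^{2n+1}u`" (Foias–Manley–Rosa–Temam 2001,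
Ch. II App. A (A.55) and §7; Constantin–Foias 1988, Ch. 10, (10.5); the identity behind the `H^m`
energy method, Majda–Bertozzi 2002, Prop. 3.7). Together with the even orders this gives the balance
of every integer Sobolev level.

Also here, for the `k = 3` step of the regularity ladder on `T³` (Robinson–Rodrigo–Sadowski 2016,
Thm 7.1 (7.3)): Young's inequality for `L²` pairings `Torus.abs_integral_inner_le_integral_norm_sq`;
the flux bound of the `H²` balance keeping half of the dissipation,
`Torus.IsClassicalNSSolutionOn.laplacian_flux_le_half`
(`−ν‖∇Δu‖₂² − ∫ ⟪(u·∇)u − f, ΔΔu⟫ ≤ −(ν/2)‖∇Δu‖₂² + ν⁻¹ (‖∇f‖₂² + C (‖∇u‖₂² + ‖Δu‖₂²) ‖Δu‖₂²)`, zero-mean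
slices — the retained `−(ν/2)‖∇Δu‖₂²` is what produces a time with small `H³` norm); and the flux bound
of the `H³` balance `Torus.IsClassicalNSSolutionOn.gradNormSq_laplacian_flux_le`
(`−ν‖Δ²u‖₂² + ∫ ⟪(u·∇)u − f, Δ³u⟫ ≤ −(ν/2)‖Δ²u‖₂² + ν⁻¹ (‖Δf‖₂² + ‖Δ((u·∇)u)‖₂²)`, in which the `H²` norm of
the inertial term is left symbolic; it is bounded by `FunctionSpaces/TorusConvectionLaplacianNormSq.lean`).
Deliberately NOT here: the `H³` smoothing estimate itself (`TorusClassicalNSH3Smoothing.lean`).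

## Mathlib / tree search

Tree (reused): `Torus.IsSmoothSpaceTimeOn.laplacian_iterate`, `Torus.timeDerivWithin_laplacian_iterate_comm`,
`Torus.timeDerivWithin_partialDeriv_comm`, `Torus.isSmooth_laplacian_iterate` (`TorusInverseLaplacian(Calculus)`,
`TorusFourierConvolution`), `Torus.sum_integral_inner_partialDeriv_eq_neg_integral_inner_laplacian`,
`Torus.IsDivFree.laplacian_iterate_of_isSmooth`, `Torus.integral_inner_laplacian_iterate_comm`
(`TorusClassicalH1Balance`, `TorusClassicalHnBalance`), `Torus.integral_inner_laplacian_comm`,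
`Torus.integral_inner_gradient_eq_zero_of_isDivFree` (`TorusFluidGlueProofs`),
`Torus.abs_integral_inner_laplacian_le_gradNormSq`, `Torus.gradNormSq_convect_self_le`
(`TorusClassicalNSH2Smoothing`, `TorusConvectionGradNormSq`), `Torus.IsSmoothSpaceTimeOn.hasDerivWithinAt_integral`,
`….hasDerivWithinAt_slice`. Searched `gradNormSq (laplacian` with `hasDerivWithinAt`, `odd order`, `H3 balance`,
`abs_integral_inner_le_integral_norm_sq`: no odd-order balance and no plain `L²` Young lemma for smooth torus
fields (`Torus.abs_integral_inner_le_of_norm_le` of `AlexakisDoeringProofs` is an `L^∞ × L¹` bound).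

## References

* C. Foias, O. Manley, R. Rosa, R. Temam, *Navier–Stokes Equations and Turbulence*, CUP 2001,
  Ch. II App. A (A.55) and §7. [FoiasManleyRosaTemam2001]
* P. Constantin, C. Foias, *Navier–Stokes Equations*, Univ. Chicago Press 1988, Ch. 10, (10.5) and
  Thm 10.6. [ConstantinFoiasNSE1988]
* J. C. Robinson, J. L. Rodrigo, W. Sadowski, *The Three-Dimensional Navier–Stokes Equations*, CUP 2016,
  Thm 7.1, (7.3). [RobinsonRodrigoSadowskiCUP2016]
-/

noncomputable section

open MeasureTheory Set Function Filter
open scoped ContDiff InnerProductSpace RealInnerProductSpace Topology NNReal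

namespace Literature.Analysis.FluidPDE

open Literature.Analysis.FunctionSpaces

variable {d : Type*} [Fintype d] [DecidableEq d]

/-! ### Young's inequality for `L²` pairings -/

omit [DecidableEq d] in
/-- **`|∫ ⟪a, b⟫| ≤ (ε/2) ∫ ‖a‖² + (2ε)⁻¹ ∫ ‖b‖²`** for smooth fields on `T^d` and `ε > 0` (pointwise
`|⟪p, q⟫| ≤ ‖p‖‖q‖ ≤ (ε/2)‖p‖² + (2ε)⁻¹‖q‖²`, integrated). [folklore] -/
theorem Torus.abs_integral_inner_le_integral_norm_sq {a b : UnitAddTorus d → EuclideanSpace ℝ d}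
    (ha : Torus.IsSmooth a) (hb : Torus.IsSmooth b) {ε : ℝ} (hε : 0 < ε) :
    |∫ x, ⟪a x, b x⟫| ≤ ε / 2 * (∫ x, ‖a x‖ ^ 2) + (2 * ε)⁻¹ * ∫ x, ‖b x‖ ^ 2 := by
  have hyoung : ∀ (p q : EuclideanSpace ℝ d), |⟪p, q⟫| ≤ ε / 2 * ‖p‖ ^ 2 + (2 * ε)⁻¹ * ‖q‖ ^ 2 := by
    intro p q
    refine (abs_real_inner_le_norm p q).trans ?_
    rw [← sub_nonneg]
    have h2 : ε / 2 * ‖p‖ ^ 2 + (2 * ε)⁻¹ * ‖q‖ ^ 2 - ‖p‖ * ‖q‖ = (ε * ‖p‖ - ‖q‖) ^ 2 / (2 * ε) := by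
      field_simp
      ring
    rw [h2]
    positivity
  have hint : Integrable (fun x => ⟪a x, b x⟫) volume := (ha.inner hb).integrable
  have hia : Integrable (fun x => ‖a x‖ ^ 2) volume := (ha.norm_sq).integrable
  have hib : Integrable (fun x => ‖b x‖ ^ 2) volume := (hb.norm_sq).integrable
  rw [← integral_const_mul, ← integral_const_mul, ← integral_add (hia.const_mul _) (hib.const_mul _)]
  exact abs_integral_le_integral_abs.trans
    (integral_mono hint.abs ((hia.const_mul _).add (hib.const_mul _)) fun x => hyoung _ _)

/-! ### The balance of `½‖∇Δⁿu‖₂²` -/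

/-- The force slice of a classical solution on `[a, b]`, `a < b`, is smooth (it is determined by the
momentum equation). [folklore] -/
-- adapted from the private lemma of `TorusClassicalNSH2Smoothing` (not exported there)
private theorem isSmooth_force_slice {a b ν : ℝ} {f u : ℝ → UnitAddTorus d → EuclideanSpace ℝ d}
    {p : ℝ → UnitAddTorus d → ℝ} (h : Torus.IsClassicalNSSolutionOn (Icc a b) ν f u p) (hab : a < b)
    {t : ℝ} (ht : t ∈ Icc a b) : Torus.IsSmooth (f t) := by
  have hut : Torus.IsSmooth (u t) := h.smooth_velocity.isSmooth_slice ht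
  have hA : Torus.IsSmooth (Torus.timeDerivWithin (Icc a b) u t) :=
    h.smooth_velocity.isSmooth_timeDerivWithin (uniqueDiffOn_Icc hab) ht
  have hpt : Torus.IsSmooth (p t) := h.smooth_pressure.isSmooth_slice ht
  have hfun : f t = fun x => Torus.timeDerivWithin (Icc a b) u t x +
      Torus.convect (u t) (u t) x - ν • Torus.laplacian (u t) x + Torus.gradient (p t) x := by
    funext x
    rw [h.momentum t ht x]
    abel
  rw [hfun]
  exact ((hA.add (hut.convect hut)).sub (hut.laplacian.smul ν)).add hpt.gradient

/-- **The odd-order Sobolev balances of classical Navier–Stokes solutions on the torus.** For a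
classical solution of `∂ₜu + (u·∇)u = νΔu − ∇p + f`, `div u = 0` on `T^d × [a, b]`, `a < b`, every
`n : ℕ` and every `t ∈ [a, b]`,
`d/dt ½‖∇Δⁿu(t)‖₂² = −ν ∫ ‖Δⁿ⁺¹u(t)‖² + ∫ ⟪(u·∇)u(t) − f(t), Δ²ⁿ⁺¹u(t)⟫`
as a one-sided derivative within `[a, b]` ("the inner product of the momentum equation with
`A^{2n+1}u`", `A = −Δ`; `n = 0` is the enstrophy equation (A.55) of Foias–Manley–Rosa–Temam 2001,
App. II.A; the general case is the identity behind the `H^m` energy method). Proof: differentiate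
`½ ∫ ∑ᵢ ‖∂ᵢΔⁿu‖²` under the integral, `∂ₜ∂ᵢΔⁿ = ∂ᵢΔⁿ∂ₜ`, Green twice
(`∑ᵢ ∫ ⟪∂ᵢΔⁿ∂ₜu, ∂ᵢΔⁿu⟫ = −∫ ⟪∂ₜu, Δ²ⁿ⁺¹u⟫`), insert the momentum equation, drop `∫ ⟪∇p, Δ²ⁿ⁺¹u⟫ = 0`.
[cite: FoiasManleyRosaTemam2001, Ch. II App. A (A.55) and §7] -/
theorem _root_.Literature.Analysis.FunctionSpaces.Torus.IsClassicalNSSolutionOn.hasDerivWithinAt_half_gradNormSq_laplacian_iterate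
    {a b ν : ℝ} {f u : ℝ → UnitAddTorus d → EuclideanSpace ℝ d} {p : ℝ → UnitAddTorus d → ℝ}
    (h : Torus.IsClassicalNSSolutionOn (Icc a b) ν f u p) (hab : a < b) (n : ℕ) {t : ℝ}
    (ht : t ∈ Icc a b) :
    HasDerivWithinAt (fun s => 2⁻¹ * Torus.gradNormSq (Torus.laplacian^[n] (u s)))
      (-ν * (∫ x, ‖(Torus.laplacian^[n + 1] (u t)) x‖ ^ 2) +
        ∫ x, ⟪Torus.convect (u t) (u t) x - f t x, (Torus.laplacian^[2 * n + 1] (u t)) x⟫) (Icc a b) t := by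
  set S : Set ℝ := Icc a b with hSdef
  have hSc : Convex ℝ S := convex_Icc a b
  have hU : UniqueDiffOn ℝ S := uniqueDiffOn_Icc hab
  have hu : Torus.IsSmoothSpaceTimeOn S u := h.smooth_velocity
  have hut : Torus.IsSmooth (u t) := hu.isSmooth_slice ht
  have hpt : Torus.IsSmooth (p t) := h.smooth_pressure.isSmooth_slice ht
  have hA : Torus.IsSmooth (Torus.timeDerivWithin S u t) := hu.isSmooth_timeDerivWithin hU ht
  have hΔ : Torus.IsSmooth (Torus.laplacian (u t)) := hut.laplacian
  have hW : Torus.IsSmoothSpaceTimeOn S (fun s => Torus.laplacian^[n] (u s)) := hu.laplacian_iterate hU n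
  have hWt : Torus.IsSmooth (Torus.laplacian^[n] (u t)) := Torus.isSmooth_laplacian_iterate hut n
  have hnA : Torus.IsSmooth (Torus.laplacian^[n] (Torus.timeDerivWithin S u t)) :=
    Torus.isSmooth_laplacian_iterate hA n
  have hZ : Torus.IsSmooth (Torus.laplacian^[2 * n + 1] (u t)) := Torus.isSmooth_laplacian_iterate hut (2 * n + 1)
  have hDi : ∀ i, Torus.IsSmoothSpaceTimeOn S (fun s => Torus.partialDeriv i (Torus.laplacian^[n] (u s))) :=
    fun i => hW.partialDeriv hU i
  -- iterate bookkeeping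
  have h2n1 : ∀ v : UnitAddTorus d → EuclideanSpace ℝ d,
      Torus.laplacian^[n] (Torus.laplacian (Torus.laplacian^[n] v)) = Torus.laplacian^[2 * n + 1] v := by
    intro v
    rw [← Function.iterate_succ_apply' Torus.laplacian n v, ← Function.iterate_add_apply]
    congr 1
    omega
  have hn1 : ∀ v : UnitAddTorus d → EuclideanSpace ℝ d,
      Torus.laplacian^[n] (Torus.laplacian v) = Torus.laplacian^[n + 1] v := fun v => by
    rw [Function.iterate_succ_apply]
  -- Step 1: differentiate `½ ∫ ∑ᵢ ‖∂ᵢΔⁿu‖²` under the integral sign.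
  have hφ : Torus.IsSmoothSpaceTimeOn S
      (fun s x => ∑ i, ‖Torus.partialDeriv i (Torus.laplacian^[n] (u s)) x‖ ^ 2) := by
    change ContDiffOn ℝ ∞
      (fun z => ∑ i, ‖Torus.stLift (fun s => Torus.partialDeriv i (Torus.laplacian^[n] (u s))) z‖ ^ 2) (S ×ˢ univ)
    exact ContDiffOn.sum fun i _ => (hDi i).norm_sq ℝ
  have hE : HasDerivWithinAt (fun s => 2⁻¹ * Torus.gradNormSq (Torus.laplacian^[n] (u s)))
      (2⁻¹ * ∫ x, Torus.timeDerivWithin S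
        (fun s x => ∑ i, ‖Torus.partialDeriv i (Torus.laplacian^[n] (u s)) x‖ ^ 2) t x) S t :=
    (hφ.hasDerivWithinAt_integral hSc ht).const_mul 2⁻¹
  -- Step 2: `∂ₜ ∑ᵢ ‖∂ᵢΔⁿu‖² = 2 ∑ᵢ ⟪∂ᵢΔⁿ∂ₜu, ∂ᵢΔⁿu⟫`.
  have hcomm : Torus.timeDerivWithin S (fun s => Torus.laplacian^[n] (u s)) t =
      Torus.laplacian^[n] (Torus.timeDerivWithin S u t) :=
    funext fun x => Torus.timeDerivWithin_laplacian_iterate_comm hab hu n ht x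
  have htd : ∀ x, Torus.timeDerivWithin S
      (fun s x => ∑ i, ‖Torus.partialDeriv i (Torus.laplacian^[n] (u s)) x‖ ^ 2) t x =
      2 * ∑ i, ⟪Torus.partialDeriv i (Torus.laplacian^[n] (Torus.timeDerivWithin S u t)) x,
        Torus.partialDeriv i (Torus.laplacian^[n] (u t)) x⟫ := by
    intro x
    have hsum := HasDerivWithinAt.fun_sum (u := Finset.univ)
      (A := fun i s => ‖Torus.partialDeriv i (Torus.laplacian^[n] (u s)) x‖ ^ 2)
      (A' := fun i => 2 * ⟪Torus.partialDeriv i (Torus.laplacian^[n] (u t)) x,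
        Torus.timeDerivWithin S (fun s => Torus.partialDeriv i (Torus.laplacian^[n] (u s))) t x⟫)
      (x := t) (s := S) fun i _ => ((hDi i).hasDerivWithinAt_slice ht x).norm_sq
    have h2 := hsum.derivWithin (hU t ht)
    rw [Torus.timeDerivWithin, h2, Finset.mul_sum]
    refine Finset.sum_congr rfl fun i _ => ?_
    rw [Torus.timeDerivWithin_partialDeriv_comm hab hW ht i x, hcomm, real_inner_comm]
  -- Step 3: Green twice, `∑ᵢ ∫ ⟪∂ᵢΔⁿ∂ₜu, ∂ᵢΔⁿu⟫ = -∫ ⟪∂ₜu, Δ²ⁿ⁺¹u⟫`.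
  have hE' : 2⁻¹ * ∫ x, Torus.timeDerivWithin S
        (fun s x => ∑ i, ‖Torus.partialDeriv i (Torus.laplacian^[n] (u s)) x‖ ^ 2) t x =
      -∫ x, ⟪Torus.timeDerivWithin S u t x, (Torus.laplacian^[2 * n + 1] (u t)) x⟫ := by
    simp_rw [htd, integral_const_mul]
    rw [integral_finsetSum _ fun i _ => ((hnA.partialDeriv i).inner (hWt.partialDeriv i)).integrable,
      Torus.sum_integral_inner_partialDeriv_eq_neg_integral_inner_laplacian hnA hWt,
      Torus.integral_inner_laplacian_iterate_comm n hA hWt.laplacian, h2n1]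
    ring
  rw [hE'] at hE
  convert hE using 1
  -- Step 4: insert the momentum equation; the pressure term drops out.
  have hA_eq : ∀ x, Torus.timeDerivWithin S u t x = ν • Torus.laplacian (u t) x -
      Torus.gradient (p t) x + f t x - Torus.convect (u t) (u t) x := by
    intro x
    rw [← h.momentum t ht x]
    abel
  have hf : Torus.IsSmooth (f t) := isSmooth_force_slice h hab ht
  have iL : Integrable (fun x => ⟪ν • Torus.laplacian (u t) x, (Torus.laplacian^[2 * n + 1] (u t)) x⟫) volume :=
    ((hΔ.smul ν).inner hZ).integrable
  have iG : Integrable (fun x => ⟪Torus.gradient (p t) x, (Torus.laplacian^[2 * n + 1] (u t)) x⟫) volume :=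
    (hpt.gradient.inner hZ).integrable
  have iF : Integrable (fun x => ⟪f t x, (Torus.laplacian^[2 * n + 1] (u t)) x⟫) volume :=
    (hf.inner hZ).integrable
  have iC : Integrable (fun x => ⟪Torus.convect (u t) (u t) x, (Torus.laplacian^[2 * n + 1] (u t)) x⟫) volume :=
    ((hut.convect hut).inner hZ).integrable
  have hsplit : ∫ x, ⟪Torus.timeDerivWithin S u t x, (Torus.laplacian^[2 * n + 1] (u t)) x⟫ =
      (∫ x, ⟪ν • Torus.laplacian (u t) x, (Torus.laplacian^[2 * n + 1] (u t)) x⟫) -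
        (∫ x, ⟪Torus.gradient (p t) x, (Torus.laplacian^[2 * n + 1] (u t)) x⟫) +
        (∫ x, ⟪f t x, (Torus.laplacian^[2 * n + 1] (u t)) x⟫) -
        ∫ x, ⟪Torus.convect (u t) (u t) x, (Torus.laplacian^[2 * n + 1] (u t)) x⟫ := by
    simp_rw [hA_eq, inner_sub_left, inner_add_left, inner_sub_left]
    rw [integral_sub ?_ iC, integral_add ?_ iF, integral_sub iL iG]
    · exact iL.sub iG
    · exact (iL.sub iG).add iF
  -- the viscous term: `ν ∫ ⟪Δu, Δ²ⁿ⁺¹u⟫ = ν ∫ ⟪Δⁿ(Δu), Δⁿ(Δu)⟫ = ν ‖Δⁿ⁺¹u‖₂²`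
  have hvisc : ∫ x, ⟪ν • Torus.laplacian (u t) x, (Torus.laplacian^[2 * n + 1] (u t)) x⟫ =
      ν * ∫ x, ‖(Torus.laplacian^[n + 1] (u t)) x‖ ^ 2 := by
    have hnΔ : Torus.IsSmooth (Torus.laplacian^[n] (Torus.laplacian (u t))) := Torus.isSmooth_laplacian_iterate hΔ n
    have e1 : ∫ x, ⟪ν • Torus.laplacian (u t) x, (Torus.laplacian^[2 * n + 1] (u t)) x⟫ =
        ν * ∫ x, ⟪Torus.laplacian (u t) x,
          (Torus.laplacian^[n] (Torus.laplacian (Torus.laplacian^[n] (u t)))) x⟫ := by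
      rw [← integral_const_mul, h2n1]
      refine integral_congr_ae (ae_of_all _ fun x => ?_)
      simp only [real_inner_smul_left]
    have e2 : Torus.laplacian (Torus.laplacian^[n] (u t)) = Torus.laplacian^[n] (Torus.laplacian (u t)) := by
      rw [← Function.iterate_succ_apply' Torus.laplacian n, Function.iterate_succ_apply]
    rw [e1, e2, ← Torus.integral_inner_laplacian_iterate_comm n hΔ hnΔ, hn1]
    congr 1
    refine integral_congr_ae (ae_of_all _ fun x => ?_)
    simp only [real_inner_self_eq_norm_sq]
  have hpres : ∫ x, ⟪Torus.gradient (p t) x, (Torus.laplacian^[2 * n + 1] (u t)) x⟫ = 0 :=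
    Torus.integral_inner_gradient_eq_zero_of_isDivFree hZ hpt
      (Torus.IsDivFree.laplacian_iterate_of_isSmooth hut (h.divFree t ht) (2 * n + 1))
  have hCF : ∫ x, ⟪Torus.convect (u t) (u t) x - f t x, (Torus.laplacian^[2 * n + 1] (u t)) x⟫ =
      (∫ x, ⟪Torus.convect (u t) (u t) x, (Torus.laplacian^[2 * n + 1] (u t)) x⟫) -
        ∫ x, ⟪f t x, (Torus.laplacian^[2 * n + 1] (u t)) x⟫ := by
    simp_rw [inner_sub_left]
    exact integral_sub iC iF
  rw [hsplit, hvisc, hpres, hCF]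
  ring

/-- **The `H³` balance of classical Navier–Stokes solutions on the torus** (the case `n = 1` of
`….hasDerivWithinAt_half_gradNormSq_laplacian_iterate`, spelled without iterates):
`d/dt ½‖∇Δu(t)‖₂² = −ν ∫ ‖ΔΔu(t)‖² + ∫ ⟪(u·∇)u(t) − f(t), ΔΔΔu(t)⟫` within `[a, b]`.
[cite: FoiasManleyRosaTemam2001, Ch. II App. A (A.55) and §7] -/
theorem _root_.Literature.Analysis.FunctionSpaces.Torus.IsClassicalNSSolutionOn.hasDerivWithinAt_half_gradNormSq_laplacian
    {a b ν : ℝ} {f u : ℝ → UnitAddTorus d → EuclideanSpace ℝ d} {p : ℝ → UnitAddTorus d → ℝ}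
    (h : Torus.IsClassicalNSSolutionOn (Icc a b) ν f u p) (hab : a < b) {t : ℝ} (ht : t ∈ Icc a b) :
    HasDerivWithinAt (fun s => 2⁻¹ * Torus.gradNormSq (Torus.laplacian (u s)))
      (-ν * (∫ x, ‖Torus.laplacian (Torus.laplacian (u t)) x‖ ^ 2) +
        ∫ x, ⟪Torus.convect (u t) (u t) x - f t x,
          Torus.laplacian (Torus.laplacian (Torus.laplacian (u t))) x⟫) (Icc a b) t :=
  -- `Δ^[1] v = Δ v`, `Δ^[1 + 1] v = Δ (Δ v)` and `Δ^[2 * 1 + 1] v = Δ (Δ (Δ v))` hold by `rfl`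
  h.hasDerivWithinAt_half_gradNormSq_laplacian_iterate hab 1 ht

/-! ### The flux bounds of the `H²` and `H³` balances on `T³` -/

/-- **Flux bound of the `H²` balance on `T³` keeping half of the dissipation.** On `T^d` with
`card d = 3` there is `C ≥ 0` such that for every `ν > 0` and every classical solution on `[a, b]`,
`a < b`, at every `t ∈ [a, b]` with `∫ u(t) = 0`,
`−ν‖∇Δu‖₂² − ∫ ⟪(u·∇)u − f, ΔΔu⟫ ≤ −(ν/2)‖∇Δu‖₂² + ν⁻¹ (‖∇f‖₂² + C (‖∇u‖₂² + ‖Δu‖₂²) ‖Δu‖₂²)`: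
both pairings by `Torus.abs_integral_inner_laplacian_le_gradNormSq` with `ε = 2ν⁻¹` (each absorbing
`(ν/4)‖∇Δu‖₂²`), then `‖∇((u·∇)u)‖₂² ≤ C (‖∇u‖₂² + ‖Δu‖₂²) ‖Δu‖₂²` (`Torus.gradNormSq_convect_self_le`).
Compared with `….laplacian_flux_le` the constant doubles but `−(ν/2)‖∇Δu‖₂²` survives, which is the
term that yields a time of controlled `H³` norm in the `k = 3` step of the ladder.
[cite: RobinsonRodrigoSadowskiCUP2016, Thm 7.1 (7.3)] -/
theorem _root_.Literature.Analysis.FunctionSpaces.Torus.IsClassicalNSSolutionOn.laplacian_flux_le_half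
    (hd : Fintype.card d = 3) :
    ∃ C : ℝ, 0 ≤ C ∧ ∀ (ν : ℝ), 0 < ν → ∀ {a b : ℝ} {f u : ℝ → UnitAddTorus d → EuclideanSpace ℝ d}
      {p : ℝ → UnitAddTorus d → ℝ}, Torus.IsClassicalNSSolutionOn (Icc a b) ν f u p → a < b →
      ∀ {t : ℝ}, t ∈ Icc a b → Torus.HasZeroMean (u t) →
        -ν * Torus.gradNormSq (Torus.laplacian (u t)) -
            ∫ x, ⟪Torus.convect (u t) (u t) x - f t x, Torus.laplacian (Torus.laplacian (u t)) x⟫ ≤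
          -(ν / 2) * Torus.gradNormSq (Torus.laplacian (u t)) +
            ν⁻¹ * (Torus.gradNormSq (f t) +
              C * (Torus.gradNormSq (u t) + ∫ x, ‖Torus.laplacian (u t) x‖ ^ 2) *
                ∫ x, ‖Torus.laplacian (u t) x‖ ^ 2) := by
  obtain ⟨C, hC0, hC⟩ := Torus.gradNormSq_convect_self_le (d := d) hd
  refine ⟨C, hC0, fun ν hν a b f u p h hab t ht h0 => ?_⟩
  have hut : Torus.IsSmooth (u t) := h.smooth_velocity.isSmooth_slice ht
  have hft : Torus.IsSmooth (f t) := isSmooth_force_slice h hab ht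
  have hB : Torus.IsSmooth (Torus.convect (u t) (u t)) := hut.convect hut
  have hΔ : Torus.IsSmooth (Torus.laplacian (u t)) := hut.laplacian
  have hΔΔ : Torus.IsSmooth (Torus.laplacian (Torus.laplacian (u t))) := hΔ.laplacian
  have hε : 0 < 2 * ν⁻¹ := by positivity
  have h1 := Torus.abs_integral_inner_laplacian_le_gradNormSq hB hΔ hε
  have h2 := Torus.abs_integral_inner_laplacian_le_gradNormSq hft hΔ hε
  have h3 := hC (u t) hut h0
  have iC : Integrable (fun x => ⟪Torus.convect (u t) (u t) x, Torus.laplacian (Torus.laplacian (u t)) x⟫)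
      volume := (hB.inner hΔΔ).integrable
  have iF : Integrable (fun x => ⟪f t x, Torus.laplacian (Torus.laplacian (u t)) x⟫) volume :=
    (hft.inner hΔΔ).integrable
  have hsplit : ∫ x, ⟪Torus.convect (u t) (u t) x - f t x, Torus.laplacian (Torus.laplacian (u t)) x⟫ =
      (∫ x, ⟪Torus.convect (u t) (u t) x, Torus.laplacian (Torus.laplacian (u t)) x⟫) -
        ∫ x, ⟪f t x, Torus.laplacian (Torus.laplacian (u t)) x⟫ := by
    simp_rw [inner_sub_left]
    exact integral_sub iC iF
  rw [hsplit]
  have hc1 : 2 * ν⁻¹ / 2 = ν⁻¹ := by ring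
  have hc2 : (2 * (2 * ν⁻¹))⁻¹ = ν / 4 := by
    rw [mul_inv, mul_inv, inv_inv]; ring
  rw [hc1, hc2] at h1 h2
  have h1' := (neg_le_abs _).trans h1
  have h2' := (le_abs_self _).trans h2
  have hZ0 : 0 ≤ Torus.gradNormSq (Torus.laplacian (u t)) := Torus.gradNormSq_nonneg _
  have h4 : ν⁻¹ * Torus.gradNormSq (Torus.convect (u t) (u t)) ≤
      ν⁻¹ * (C * (Torus.gradNormSq (u t) + ∫ x, ‖Torus.laplacian (u t) x‖ ^ 2) *
        ∫ x, ‖Torus.laplacian (u t) x‖ ^ 2) := mul_le_mul_of_nonneg_left h3 (inv_pos.2 hν).le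
  rw [mul_add]
  linarith [h1', h2', h4]

/-- **Flux bound of the `H³` balance on `T^d` (any dimension), the `H²` norm of the inertial term left
symbolic.** For `ν > 0` and a classical solution on `[a, b]`, `a < b`, at every `t ∈ [a, b]`,
`−ν‖ΔΔu‖₂² + ∫ ⟪(u·∇)u − f, ΔΔΔu⟫ ≤ −(ν/2)‖ΔΔu‖₂² + ν⁻¹ (‖Δf‖₂² + ‖Δ((u·∇)u)‖₂²)`: move one Laplacian
across (`∫ ⟪v, ΔΔΔu⟫ = ∫ ⟪Δv, ΔΔu⟫`, Green's second identity) and apply Young's inequality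
`Torus.abs_integral_inner_le_integral_norm_sq` with `ε = 2ν⁻¹` to both pairings. On `T³`,
`‖Δ((u·∇)u)‖₂² ≤ C (‖∇u‖₂² + ‖Δu‖₂²)(‖Δu‖₂² + ‖∇Δu‖₂²)` (`FunctionSpaces/TorusConvectionLaplacianNormSq`) turns
this into the differential inequality (7.3) of Robinson–Rodrigo–Sadowski 2016 for `k = 3`.
[cite: RobinsonRodrigoSadowskiCUP2016, Thm 7.1 (7.3)] -/
theorem _root_.Literature.Analysis.FunctionSpaces.Torus.IsClassicalNSSolutionOn.gradNormSq_laplacian_flux_le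
    {ν : ℝ} (hν : 0 < ν) {a b : ℝ} {f u : ℝ → UnitAddTorus d → EuclideanSpace ℝ d}
    {p : ℝ → UnitAddTorus d → ℝ} (h : Torus.IsClassicalNSSolutionOn (Icc a b) ν f u p) (hab : a < b)
    {t : ℝ} (ht : t ∈ Icc a b) :
    -ν * (∫ x, ‖Torus.laplacian (Torus.laplacian (u t)) x‖ ^ 2) +
        ∫ x, ⟪Torus.convect (u t) (u t) x - f t x, Torus.laplacian (Torus.laplacian (Torus.laplacian (u t))) x⟫ ≤
      -(ν / 2) * (∫ x, ‖Torus.laplacian (Torus.laplacian (u t)) x‖ ^ 2) +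
        ν⁻¹ * ((∫ x, ‖Torus.laplacian (f t) x‖ ^ 2) +
          ∫ x, ‖Torus.laplacian (Torus.convect (u t) (u t)) x‖ ^ 2) := by
  have hut : Torus.IsSmooth (u t) := h.smooth_velocity.isSmooth_slice ht
  have hft : Torus.IsSmooth (f t) := isSmooth_force_slice h hab ht
  have hB : Torus.IsSmooth (Torus.convect (u t) (u t)) := hut.convect hut
  have hΔ : Torus.IsSmooth (Torus.laplacian (u t)) := hut.laplacian
  have hΔΔ : Torus.IsSmooth (Torus.laplacian (Torus.laplacian (u t))) := hΔ.laplacian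
  have hΔΔΔ : Torus.IsSmooth (Torus.laplacian (Torus.laplacian (Torus.laplacian (u t)))) := hΔΔ.laplacian
  have iC : Integrable (fun x => ⟪Torus.convect (u t) (u t) x,
      Torus.laplacian (Torus.laplacian (Torus.laplacian (u t))) x⟫) volume := (hB.inner hΔΔΔ).integrable
  have iF : Integrable (fun x => ⟪f t x, Torus.laplacian (Torus.laplacian (Torus.laplacian (u t))) x⟫) volume :=
    (hft.inner hΔΔΔ).integrable
  have hsplit : ∫ x, ⟪Torus.convect (u t) (u t) x - f t x, Torus.laplacian (Torus.laplacian (Torus.laplacian (u t))) x⟫ =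
      (∫ x, ⟪Torus.laplacian (Torus.convect (u t) (u t)) x, Torus.laplacian (Torus.laplacian (u t)) x⟫) -
        ∫ x, ⟪Torus.laplacian (f t) x, Torus.laplacian (Torus.laplacian (u t)) x⟫ := by
    simp_rw [inner_sub_left]
    rw [integral_sub iC iF, Torus.integral_inner_laplacian_comm hB hΔΔ, Torus.integral_inner_laplacian_comm hft hΔΔ]
  rw [hsplit]
  have hε : 0 < 2 * ν⁻¹ := by positivity
  have h1 := Torus.abs_integral_inner_le_integral_norm_sq hB.laplacian hΔΔ hε
  have h2 := Torus.abs_integral_inner_le_integral_norm_sq hft.laplacian hΔΔ hε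
  have hc1 : 2 * ν⁻¹ / 2 = ν⁻¹ := by ring
  have hc2 : (2 * (2 * ν⁻¹))⁻¹ = ν / 4 := by
    rw [mul_inv, mul_inv, inv_inv]; ring
  rw [hc1, hc2] at h1 h2
  have h1' := (le_abs_self _).trans h1
  have h2' := (neg_le_abs _).trans h2
  rw [mul_add]
  linarith [h1', h2']

end Literature.Analysis.FluidPDE

end
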